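import Summits.Ventures.CertifiedQuantumChemistry.Rows.SectorRows
import Literature.MathematicalPhysics.QuantumLattice.HubbardLiebBasis
import HarnessLib

/-!
# Ventures/CertifiedQuantumChemistry — Rows/SingletRows.lean: the `⟨Ŝ²⟩ = 0` (singlet) certificates

HONEST FRAMING (verbatim): certified bounds for a stated model Hamiltonian in a stated basis; not a
claim about the real molecule beyond that model.

Soundness of the SINGLET-RESTRICTED rows of `Statement.lean` (DRAFT v0.2: `singletSector`,
`Model.singletEnergy`, `SingletLowerRow`, `SingletUpperRow`). A FORMAT-qcl1 certificate with the spin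
equality row E3 (`S = 0`, `⟨Ŝ_−Ŝ_+⟩-form`, rhs `S(S+1) − M(M+1) = 0`) is an operator identity of the
shape of `LowerCertificate` with ONE MORE two-sided ideal, generated by `Ŝ_−Ŝ_+` (free-sign multiplier
of the equality row). In the tracial state of the ground projection of `H_F` restricted to the singlet
subspace `K = (n,n)-sector ⊓ ker Ŝ_+` every ideal term vanishes (`N̂_σ = n`, `Ŝ_−Ŝ_+ = 0` on `K`), the
Gram, commutator, charged-word and anti-Hermitian terms are handled exactly as in `Rows/SectorRows.lean`
(same engine `Matrix.re_projState_ge_of_local_certificate`), and `K` is `H_F`-invariant because the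
spin-free Hamiltonian commutes with `Ŝ_+` (`molecularHamiltonian_commute_spinPlus`, HJO §2.3.4) — so
the certificate proves `lo ≤ Model.singletEnergy F n`. Also: the singlet Rayleigh–Ritz upper
predicate, `Model.energy F n n ≤ Model.singletEnergy F n`, and the two weakenings
`LowerRow F n n lo → SingletLowerRow F n lo`, `SingletUpperRow F n hi → UpperRow F n n hi`.
-/

noncomputable section

namespace Summit.Ventures.CertifiedQuantumChemistry

open Matrix Finset
open Literature.MathematicalPhysics.QuantumLattice Literature.MathematicalPhysics.QuantumChemistry
open Literature.MathematicalPhysics.QuantumManyBody.StateRelaxation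
open scoped ComplexOrder

/-! ## Generic: a spin-resolved sector certificate with an extra `Ŝ_−Ŝ_+` ideal -/

section Generic

variable {Λ : Type*} [LinearOrder Λ] [Fintype Λ]

/-- `Ŝ_−Ŝ_+` is Hermitian (`Ŝ_− = Ŝ_+†`). -/
theorem isHermitian_spinMinus_mul_spinPlus :
    (spinMinus * spinPlus : Matrix (Finset (Orb Λ)) (Finset (Orb Λ)) ℂ).IsHermitian := by
  rw [Matrix.IsHermitian, conjTranspose_mul, spinMinus, conjTranspose_conjTranspose]

/-- The closed-shell determinant `|α↑ α↓⟩` is annihilated by `Ŝ_+`. -/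
theorem spinPlus_mulVec_single_pairSet_self (α : Finset Λ) :
    spinPlus *ᵥ Pi.single (pairSet α α) (1 : ℂ) = 0 := by
  ext s
  obtain ⟨β, δ, rfl⟩ : ∃ β δ, s = pairSet β δ := ⟨upPart s, downPart s, (pairSet_upPart_downPart s).symm⟩
  rw [LiebTwo.spinPlus_mulVec_pairSet, Pi.zero_apply]
  refine Finset.sum_eq_zero fun x hx => ?_
  rw [Pi.single_apply, if_neg]
  intro h
  have hu := congrArg upPart h
  have hd := congrArg downPart h
  rw [upPart_pairSet, upPart_pairSet] at hu
  rw [downPart_pairSet, downPart_pairSet] at hd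
  have hxα : x ∈ α := hd ▸ Finset.mem_insert_self x δ
  rw [← hu] at hxα
  exact Finset.notMem_erase x β hxα

/-- The singlet subspace `(n,n)-sector ⊓ ker Ŝ_+` is nonzero for `n ≤ |Λ|` (a closed-shell determinant). -/
theorem szSector_inf_ker_spinPlus_ne_bot {n : ℕ} (hn : n ≤ Fintype.card Λ) :
    szSector (n + n) (((n : ℝ) - n) / 2) ⊓ LinearMap.ker (Matrix.toLin'
      (spinPlus : Matrix (Finset (Orb Λ)) (Finset (Orb Λ)) ℂ)) ≠ ⊥ := by
  classical
  obtain ⟨α, -, hα⟩ : ∃ α : Finset Λ, α ⊆ univ ∧ α.card = n :=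
    Finset.exists_subset_card_eq (by rwa [Finset.card_univ])
  rw [Submodule.ne_bot_iff]
  refine ⟨Pi.single (pairSet α α) 1, ?_, ?_⟩
  · rw [Submodule.mem_inf, LinearMap.mem_ker, Matrix.toLin'_apply]
    refine ⟨(mem_szSector_iff_isInSector n n _).2 ?_, spinPlus_mulVec_single_pairSet_self α⟩
    have h := isInSector_single_pairSet (Λ := Λ) α α
    rwa [hα] at h
  · intro h
    have := congrFun h (pairSet α α)
    simp at this

/-- An operator commuting with `N̂`, `Ŝ_z` and `Ŝ_+` maps the singlet subspace into itself. -/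
theorem mulVec_mem_szSector_inf_ker_spinPlus {A : Matrix (Finset (Orb Λ)) (Finset (Orb Λ)) ℂ}
    (hAN : Commute A totalNumber) (hAS : Commute A HubbardWave0.spinZ) (hAP : Commute A spinPlus)
    {N : ℕ} {M : ℝ} {ψ : Fock (Orb Λ)}
    (hψ : ψ ∈ szSector N M ⊓ LinearMap.ker (Matrix.toLin'
      (spinPlus : Matrix (Finset (Orb Λ)) (Finset (Orb Λ)) ℂ))) :
    A *ᵥ ψ ∈ szSector N M ⊓ LinearMap.ker (Matrix.toLin'
      (spinPlus : Matrix (Finset (Orb Λ)) (Finset (Orb Λ)) ℂ)) := by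
  rw [Submodule.mem_inf, LinearMap.mem_ker, Matrix.toLin'_apply] at hψ ⊢
  refine ⟨mulVec_mem_szSector_of_commute hAN hAS hψ.1, ?_⟩
  rw [mulVec_mulVec, ← hAP.eq, ← mulVec_mulVec, hψ.2, mulVec_zero]

/-- **Singlet certificate ⇒ singlet energy (generic).** As
`sectorGroundEnergy_ge_of_spin_sector_certificate`, for `A` also commuting with `Ŝ_+`, in the sector
`a = b = n`, with ONE MORE two-sided ideal generated by `Ŝ_−Ŝ_+` (multipliers `Tᵢ, T'ᵢ`): the identity
proves `c − Σₖ ‖aₖ‖ ≤ minEnergyOn A ((n,n)-sector ⊓ ker Ŝ_+)`. -/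
theorem minEnergyOn_singlet_ge_of_certificate
    (A : Matrix (Finset (Orb Λ)) (Finset (Orb Λ)) ℂ) (hA : A.IsHermitian)
    (hAN : Commute A totalNumber) (hAS : Commute A HubbardWave0.spinZ) (hAP : Commute A spinPlus)
    {n : ℕ} (hn : n ≤ Fintype.card Λ)
    {m : Type*} [Fintype m] [DecidableEq m] {Λm : Matrix m m ℂ} (hΛm : Λm.PosSemidef)
    (O : m → Matrix (Finset (Orb Λ)) (Finset (Orb Λ)) ℂ)
    {κ : Type*} (s : Finset κ) (Xc : κ → Matrix (Finset (Orb Λ)) (Finset (Orb Λ)) ℂ)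
    {ρ : Type*} (r : Finset ρ) (Z Z' : ρ → Matrix (Finset (Orb Λ)) (Finset (Orb Λ)) ℂ)
    {ρ' : Type*} (r' : Finset ρ') (S S' : ρ' → Matrix (Finset (Orb Λ)) (Finset (Orb Λ)) ℂ)
    {ρ'' : Type*} (r'' : Finset ρ'') (T T' : ρ'' → Matrix (Finset (Orb Λ)) (Finset (Orb Λ)) ℂ)
    {γ : Type*} (u : Finset γ) (bc : γ → ℂ) (cw : γ → List (Orb Λ × Bool))
    (hcw : ∀ j ∈ u, ladderCharge (cw j) ≠ 0 ∨ ladderSpinCharge (cw j) ≠ 0)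
    {δ : Type*} (ah : Finset δ) (dc : δ → ℝ) (V : δ → Matrix (Finset (Orb Λ)) (Finset (Orb Λ)) ℂ)
    {κ'' : Type*} (w : Finset κ'') (ac : κ'' → ℂ) (word : κ'' → List (Orb Λ × Bool)) {c : ℝ}
    (hcert : A - (c : ℂ) • (1 : Matrix (Finset (Orb Λ)) (Finset (Orb Λ)) ℂ) =
      gramForm Λm O +
        (∑ k ∈ s, (A * Xc k - Xc k * A) +
          ∑ i ∈ r, (Z i * (∑ y : Λ, numberOp y 0 - (n : ℂ) • 1) +
            (∑ y : Λ, numberOp y 0 - (n : ℂ) • 1) * Z' i) +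
          ∑ i ∈ r', (S i * (∑ y : Λ, numberOp y 1 - (n : ℂ) • 1) +
            (∑ y : Λ, numberOp y 1 - (n : ℂ) • 1) * S' i) +
          ∑ i ∈ r'', (T i * (spinMinus * spinPlus) + (spinMinus * spinPlus) * T' i) +
          ∑ j ∈ u, bc j • ladderWord (cw j)) +
        (∑ m' ∈ ah, ((dc m' : ℝ) : ℂ) • ((V m')ᴴ - V m') + ∑ k ∈ w, ac k • ladderWord (word k))) :
    c - ∑ k ∈ w, ‖ac k‖ ≤ A.minEnergyOn (szSector (n + n) (((n : ℝ) - n) / 2) ⊓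
      LinearMap.ker (Matrix.toLin' (spinPlus : Matrix (Finset (Orb Λ)) (Finset (Orb Λ)) ℂ))) := by
  set K : Submodule ℂ (Fock (Orb Λ)) := szSector (n + n) (((n : ℝ) - n) / 2) ⊓
    LinearMap.ker (Matrix.toLin' (spinPlus : Matrix (Finset (Orb Λ)) (Finset (Orb Λ)) ℂ)) with hKdef
  have hK : K ≠ ⊥ := szSector_inf_ker_spinPlus_ne_bot hn
  have hKA : ∀ ψ ∈ K, A *ᵥ ψ ∈ K := fun ψ hψ => mulVec_mem_szSector_inf_ker_spinPlus hAN hAS hAP hψ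
  have hKsz : ∀ ψ ∈ K, ψ ∈ szSector (n + n) (((n : ℝ) - n) / 2) := fun ψ hψ =>
    (Submodule.mem_inf.1 hψ).1
  have hKP : ∀ ψ ∈ K, spinPlus *ᵥ ψ = 0 := fun ψ hψ => by
    have h := (Submodule.mem_inf.1 hψ).2
    rwa [LinearMap.mem_ker, Matrix.toLin'_apply] at h
  -- three ideals as one `Q = q` family over `(ρ ⊕ ρ') ⊕ ρ''`
  set Q : (ρ ⊕ ρ') ⊕ ρ'' → Matrix (Finset (Orb Λ)) (Finset (Orb Λ)) ℂ :=
    Sum.elim (Sum.elim (fun _ => ∑ y : Λ, numberOp y 0) (fun _ => ∑ y : Λ, numberOp y 1))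
      (fun _ => spinMinus * spinPlus) with hQ
  set q : (ρ ⊕ ρ') ⊕ ρ'' → ℝ := Sum.elim (Sum.elim (fun _ => (n : ℝ)) (fun _ => (n : ℝ))) (fun _ => 0)
    with hq
  set ZZ : (ρ ⊕ ρ') ⊕ ρ'' → Matrix (Finset (Orb Λ)) (Finset (Orb Λ)) ℂ := Sum.elim (Sum.elim Z S) T
    with hZZ
  set ZZ' : (ρ ⊕ ρ') ⊕ ρ'' → Matrix (Finset (Orb Λ)) (Finset (Orb Λ)) ℂ := Sum.elim (Sum.elim Z' S') T'
    with hZZ'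
  have hNh : (totalNumber : Matrix (Finset (Orb Λ)) (Finset (Orb Λ)) ℂ)ᴴ = totalNumber := by
    rw [totalNumber_eq_numberDiag_univ]
    exact numberDiag_conjTranspose _
  have hQh : ∀ i ∈ (r.disjSum r').disjSum r'', (Q i).IsHermitian := by
    rintro ((i | i) | i) _
    · exact isHermitian_sum_numberOp 0
    · exact isHermitian_sum_numberOp 1
    · exact isHermitian_spinMinus_mul_spinPlus
  have hQq : ∀ i ∈ (r.disjSum r').disjSum r'', ∀ ψ ∈ K, Q i *ᵥ ψ = ((q i : ℝ) : ℂ) • ψ := by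
    rintro ((i | i) | i) _ ψ hψ
    · have h := spinNumber_mulVec_of_mem_upDownSector 0 (hKsz ψ hψ)
      simp only [Fin.isValue, if_true] at h
      exact h
    · have h := spinNumber_mulVec_of_mem_upDownSector 1 (hKsz ψ hψ)
      simp only [Fin.isValue, one_ne_zero, if_false] at h
      exact h
    · simp only [hQ, hq, Sum.elim_inr]
      rw [← mulVec_mulVec, hKP ψ hψ, mulVec_zero, Complex.ofReal_zero, zero_smul]
  -- charged words as commutators with `N̂` / `S^z`
  set C : γ → Matrix (Finset (Orb Λ)) (Finset (Orb Λ)) ℂ :=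
    fun j => if ladderCharge (cw j) ≠ 0 then totalNumber else HubbardWave0.spinZ with hC
  set W : γ → Matrix (Finset (Orb Λ)) (Finset (Orb Λ)) ℂ :=
    fun j => (bc j / (if ladderCharge (cw j) ≠ 0 then ((ladderCharge (cw j) : ℤ) : ℂ)
      else ((ladderSpinCharge (cw j) : ℤ) : ℂ) / 2)) • ladderWord (cw j) with hW
  have hC1 : ∀ j ∈ u, C j * A = A * C j := by
    intro j _
    by_cases hq : ladderCharge (cw j) ≠ 0
    · simp only [hC, hq, ne_eq, not_false_eq_true, if_true]; exact hAN.symm.eq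
    · simp only [hC, hq, if_false]; exact hAS.symm.eq
  have hCK : ∀ j ∈ u, ∀ ψ ∈ K, C j *ᵥ ψ ∈ K := by
    intro j _ ψ hψ
    obtain ⟨hNψ, hSψ⟩ := (mem_szSector_iff _ _ ψ).1 (hKsz ψ hψ)
    by_cases hq : ladderCharge (cw j) ≠ 0
    · simp only [hC, hq, ne_eq, not_false_eq_true, if_true]
      rw [totalNumber_mulVec_of_isNParticle hNψ]
      exact Submodule.smul_mem _ _ hψ
    · simp only [hC, hq, if_false]
      rw [hSψ]
      exact Submodule.smul_mem _ _ hψ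
  have hCh : ∀ j, (C j)ᴴ = C j := by
    intro j
    by_cases hq : ladderCharge (cw j) ≠ 0
    · simp only [hC, hq, ne_eq, not_false_eq_true, if_true]; exact hNh
    · simp only [hC, hq, if_false]; exact HubbardWave0.spinZ_isHermitian.eq
  have hCK' : ∀ j ∈ u, ∀ ψ ∈ K, (C j)ᴴ *ᵥ ψ ∈ K := fun j hj ψ hψ => by
    rw [hCh j]; exact hCK j hj ψ hψ
  have hcharged : ∀ j ∈ u, C j * W j - W j * C j = bc j • ladderWord (cw j) := fun j hj =>
    (smul_ladderWord_eq_commutator_of_charged (bc j) (cw j) (hcw j hj)).symm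
  -- residual words are contractions
  have hMc : ∀ k ∈ w, (ladderWord (word k)).IsContraction := fun k _ => by
    rw [ladderWord_eq_prod]; exact isContraction_prod_ladder _
  -- the identity in the shape of the engine (no symmetry family)
  have hmid : ∑ k ∈ s, (A * Xc k - Xc k * A) +
        ∑ l ∈ (∅ : Finset Unit), ((fun _ => (1 : Matrix (Finset (Orb Λ)) (Finset (Orb Λ)) ℂ)) l *
          (fun _ => (0 : Matrix (Finset (Orb Λ)) (Finset (Orb Λ)) ℂ)) l *
          ((fun _ => (1 : Matrix (Finset (Orb Λ)) (Finset (Orb Λ)) ℂ)) l)ᴴ -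
          (fun _ => (0 : Matrix (Finset (Orb Λ)) (Finset (Orb Λ)) ℂ)) l) +
        ∑ i ∈ (r.disjSum r').disjSum r'',
          (ZZ i * (Q i - ((q i : ℝ) : ℂ) • 1) + (Q i - ((q i : ℝ) : ℂ) • 1) * ZZ' i) +
        ∑ j ∈ u, (C j * W j - W j * C j) =
      ∑ k ∈ s, (A * Xc k - Xc k * A) +
        ∑ i ∈ r, (Z i * (∑ y : Λ, numberOp y 0 - (n : ℂ) • 1) +
          (∑ y : Λ, numberOp y 0 - (n : ℂ) • 1) * Z' i) +
        ∑ i ∈ r', (S i * (∑ y : Λ, numberOp y 1 - (n : ℂ) • 1) +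
          (∑ y : Λ, numberOp y 1 - (n : ℂ) • 1) * S' i) +
        ∑ i ∈ r'', (T i * (spinMinus * spinPlus) + (spinMinus * spinPlus) * T' i) +
        ∑ j ∈ u, bc j • ladderWord (cw j) := by
    rw [Finset.sum_empty, add_zero, Finset.sum_disjSum, Finset.sum_disjSum,
      Finset.sum_congr rfl hcharged]
    simp only [hZZ, hZZ', hQ, hq, Sum.elim_inl, Sum.elim_inr, Complex.ofReal_natCast,
      Complex.ofReal_zero, zero_smul, sub_zero]
    abel
  have hcert' : A - (c : ℂ) • (1 : Matrix (Finset (Orb Λ)) (Finset (Orb Λ)) ℂ) =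
      gramForm Λm O +
        (∑ k ∈ s, (A * Xc k - Xc k * A) +
          ∑ l ∈ (∅ : Finset Unit), ((fun _ => (1 : Matrix (Finset (Orb Λ)) (Finset (Orb Λ)) ℂ)) l *
            (fun _ => (0 : Matrix (Finset (Orb Λ)) (Finset (Orb Λ)) ℂ)) l *
            ((fun _ => (1 : Matrix (Finset (Orb Λ)) (Finset (Orb Λ)) ℂ)) l)ᴴ -
            (fun _ => (0 : Matrix (Finset (Orb Λ)) (Finset (Orb Λ)) ℂ)) l) +
          ∑ i ∈ (r.disjSum r').disjSum r'',
            (ZZ i * (Q i - ((q i : ℝ) : ℂ) • 1) + (Q i - ((q i : ℝ) : ℂ) • 1) * ZZ' i) +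
          ∑ j ∈ u, (C j * W j - W j * C j)) +
        (∑ m' ∈ ah, ((dc m' : ℝ) : ℂ) • ((V m')ᴴ - V m') + ∑ k ∈ w, ac k • ladderWord (word k)) := by
    rw [hmid]; exact hcert
  have h := Matrix.re_projState_ge_of_local_certificate hA K hKA hK A hΛm O s Xc (∅ : Finset Unit)
    (fun _ => 1) (fun _ => 0) (fun _ h => absurd h (Finset.notMem_empty _))
    (fun _ h => absurd h (Finset.notMem_empty _)) (fun _ h => absurd h (Finset.notMem_empty _))
    (fun _ h => absurd h (Finset.notMem_empty _))
    ((r.disjSum r').disjSum r'') Q ZZ ZZ' q hQh hQq u C W hC1 hCK hCK' ah dc V w ac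
    (fun k => ladderWord (word k)) hMc hcert'
  rw [projState_self (sectorGroundProj_isHermitian A K) (sectorGroundProj_mul_self A K)
    (sectorGroundProj_ne_zero hA K hKA hK) (sectorGroundProj_mul hA K), Complex.ofReal_re] at h
  exact h

end Generic

/-! ## The cell's singlet certificate predicates on a model `F : Model k` -/

variable {k : ℕ}

/-- **SINGLET LOWER certificate predicate** (FORMAT-qcl1 + E3 with `S = 0`): `LowerCertificate` with
one more family of two-sided multipliers `T, T'` of the ideal generated by `Ŝ_−Ŝ_+` (the spin equality
row; rhs `S(S+1) − M(M+1) = 0`). -/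
def SingletLowerCertificate (F : Model k) (n : ℕ) (lo : ℚ) : Prop :=
  ∃ (m nX nZ nS nT nC nV nR : ℕ) (Λm : Matrix (Fin m) (Fin m) ℂ) (_ : Λm.PosSemidef) (O : Fin m → Op k)
    (X : Fin nX → Op k) (Z Z' : Fin nZ → Op k) (S S' : Fin nS → Op k) (T T' : Fin nT → Op k)
    (bc : Fin nC → ℂ) (cw : Fin nC → List (Orb (Fin k) × Bool))
    (_ : ∀ j, ladderCharge (cw j) ≠ 0 ∨ ladderSpinCharge (cw j) ≠ 0)
    (dc : Fin nV → ℝ) (V : Fin nV → Op k) (ac : Fin nR → ℂ) (v : Fin nR → List (Orb (Fin k) × Bool))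
    (c : ℝ),
    ((lo : ℚ) : ℝ) ≤ c - ∑ j, ‖ac j‖ ∧
    F.hamiltonian - (c : ℂ) • (1 : Op k) =
      gramForm Λm O +
        (∑ i, (F.hamiltonian * X i - X i * F.hamiltonian) +
          ∑ i, (Z i * (∑ y : Fin k, numberOp y 0 - (n : ℂ) • 1) +
            (∑ y : Fin k, numberOp y 0 - (n : ℂ) • 1) * Z' i) +
          ∑ i, (S i * (∑ y : Fin k, numberOp y 1 - (n : ℂ) • 1) +
            (∑ y : Fin k, numberOp y 1 - (n : ℂ) • 1) * S' i) +
          ∑ i, (T i * (spinMinus * spinPlus) + (spinMinus * spinPlus) * T' i) +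
          ∑ j, bc j • ladderWord (cw j)) +
        (∑ i, ((dc i : ℝ) : ℂ) • ((V i)ᴴ - V i) + ∑ j, ac j • ladderWord (v j))

/-- **SOUNDNESS OF SINGLET LOWER ROWS.** `SingletLowerCertificate F n lo → SingletLowerRow F n lo`
for a symmetric model and `n ≤ k`. -/
theorem singletLowerRow_of_certificate {F : Model k} (hF : F.IsSymmetric) {n : ℕ} (hn : n ≤ k)
    {lo : ℚ} (h : SingletLowerCertificate F n lo) : SingletLowerRow F n lo := by
  obtain ⟨m, nX, nZ, nS, nT, nC, nV, nR, Λm, hΛm, O, X, Z, Z', S, S', T, T', bc, cw, hcw, dc, V, ac,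
    v, c, hlo, hcert⟩ := h
  have hbound := minEnergyOn_singlet_ge_of_certificate F.hamiltonian
    (Model.hamiltonian_isHermitian hF) (molecularHamiltonian_commute_totalNumber _ _ _)
    (molecularHamiltonian_commute_spinZ _ _ _) (molecularHamiltonian_commute_spinPlus _ _ _)
    (by simpa using hn) hΛm O Finset.univ X Finset.univ Z Z' Finset.univ S S' Finset.univ T T'
    Finset.univ bc cw (fun j _ => hcw j) Finset.univ dc V Finset.univ ac v hcert
  exact ⟨hn, le_trans hlo hbound⟩

/-- A plain sector certificate is a singlet certificate (no `Ŝ_−Ŝ_+` multipliers). -/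
theorem LowerCertificate.singlet {F : Model k} {n : ℕ} {lo : ℚ} (h : LowerCertificate F n n lo) :
    SingletLowerCertificate F n lo := by
  obtain ⟨m, nX, nZ, nS, nC, nV, nR, Λm, hΛm, O, X, Z, Z', S, S', bc, cw, hcw, dc, V, ac, v, c, hlo,
    hcert⟩ := h
  refine ⟨m, nX, nZ, nS, 0, nC, nV, nR, Λm, hΛm, O, X, Z, Z', S, S', Fin.elim0, Fin.elim0, bc, cw, hcw,
    dc, V, ac, v, c, hlo, ?_⟩
  rw [hcert]
  simp

/-- **SINGLET UPPER certificate predicate**: an explicit NONZERO singlet (`Ŝ_+ψ = 0`) of the `(n, n)`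
sector with exact Rayleigh data `Re ⟨ψ, H_F ψ⟩ ≤ hi · ⟨ψ, ψ⟩`. -/
def SingletUpperCertificate (F : Model k) (n : ℕ) (hi : ℚ) : Prop :=
  ∃ ψ : Fock (Orb (Fin k)), IsInSector n n ψ ∧ spinPlus *ᵥ ψ = 0 ∧ ψ ≠ 0 ∧
    (star ψ ⬝ᵥ F.hamiltonian *ᵥ ψ).re ≤ ((hi : ℚ) : ℝ) * (star ψ ⬝ᵥ ψ).re

/-- **SOUNDNESS OF SINGLET UPPER ROWS** (Rayleigh–Ritz on the singlet subspace). -/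
theorem singletUpperRow_of_certificate {F : Model k} (hF : F.IsSymmetric) {n : ℕ} {hi : ℚ}
    (h : SingletUpperCertificate F n hi) : SingletUpperRow F n hi := by
  obtain ⟨ψ, hψ, hP, h0, hu⟩ := h
  obtain ⟨hn, -⟩ := range_of_isInSector_ne_zero hψ h0
  have hψK : ψ ∈ singletSector k n :=
    (mem_singletSector_iff ψ).2 ⟨(mem_szSector_iff_isInSector n n ψ).2 hψ, hP⟩
  have hpos : 0 < (star ψ ⬝ᵥ ψ).re := by
    have h1 : 0 < star ψ ⬝ᵥ ψ :=
      lt_of_le_of_ne (dotProduct_star_self_nonneg ψ) (Ne.symm (mt dotProduct_star_self_eq_zero.1 h0))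
    exact (Complex.pos_iff.1 h1).1
  exact ⟨hn, le_of_mul_le_mul_right ((minEnergyOn_mul_le_re_rayleigh
    (Model.hamiltonian_isHermitian hF) _ hψK).trans hu) hpos⟩

/-- A two-sided singlet row from one certificate of each kind. -/
theorem singletBracket_of_certificates {F : Model k} (hF : F.IsSymmetric) {n : ℕ} (hn : n ≤ k)
    {lo hi : ℚ} (hL : SingletLowerCertificate F n lo) (hU : SingletUpperCertificate F n hi) :
    SingletBracket F n lo hi :=
  ⟨singletLowerRow_of_certificate hF hn hL, singletUpperRow_of_certificate hF hU⟩

/-- **`E₀(N_α = N_β = n) ≤ E₀(N = 2n, S = 0)`**: the singlet energy is attained at a singlet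
eigenvector (the singlet subspace is `H_F`-invariant and nonzero for `n ≤ k`), whose Rayleigh quotient
bounds the sector energy from above. -/
theorem Model.energy_le_singletEnergy {F : Model k} (hF : F.IsSymmetric) {n : ℕ} (hn : n ≤ k) :
    F.energy n n ≤ F.singletEnergy n := by
  have hH := Model.hamiltonian_isHermitian hF
  obtain ⟨ψ, hψK, hψ1, hHψ⟩ := exists_unit_eigen_minEnergyOn hH (singletSector k n)
    (fun v hv => mulVec_mem_szSector_inf_ker_spinPlus (molecularHamiltonian_commute_totalNumber _ _ _)
      (molecularHamiltonian_commute_spinZ _ _ _) (molecularHamiltonian_commute_spinPlus _ _ _) hv)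
    (szSector_inf_ker_spinPlus_ne_bot (by simpa using hn))
  have hψ : IsInSector n n ψ :=
    (mem_szSector_iff_isInSector n n ψ).1 ((mem_singletSector_iff ψ).1 hψK).1
  have hle := sectorGroundEnergy_mul_le_re_rayleigh hH hψ
  rw [hψ1, Complex.one_re, mul_one] at hle
  change F.hamiltonian *ᵥ ψ = ((F.singletEnergy n : ℝ) : ℂ) • ψ at hHψ
  rw [hHψ, dotProduct_smul, hψ1, smul_eq_mul, mul_one, Complex.ofReal_re] at hle
  exact hle

/-- A sector lower row IS a singlet lower row (the singlet minimum is larger). -/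
theorem LowerRow.singlet {F : Model k} (hF : F.IsSymmetric) {n : ℕ} {lo : ℚ} (h : LowerRow F n n lo) :
    SingletLowerRow F n lo :=
  ⟨h.range.1, h.le.trans (Model.energy_le_singletEnergy hF h.range.1)⟩

/-- A singlet upper row IS a sector upper row. -/
theorem SingletUpperRow.upperRow {F : Model k} (hF : F.IsSymmetric) {n : ℕ} {hi : ℚ}
    (h : SingletUpperRow F n hi) : UpperRow F n n hi :=
  ⟨h.range, h.range, (Model.energy_le_singletEnergy hF h.range).trans h.le⟩

end Summit.Ventures.CertifiedQuantumChemistry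

end
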